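import Literature.Topology.Immersions.NormalEulerClass
import Literature.Topology.Immersions.ProjBundleIso
import Literature.AlgebraicTopology.CharacteristicClasses.FibrewiseContinuity
import HarnessLib

/-!
# Orientation-preserving isomorphisms of oriented plane bundles give isomorphic line bundles

Topic `Literature/Topology/Immersions`. Complement to `OrientedPlaneBundleLine.lean`
(`ProjBundle.lineCore`: an oriented rank-`2` projection-field bundle as a complex line bundle):
an isomorphism of projection-field bundles `Φ : E ≅ E'` (`ProjBundle.IsIso`, `ProjBundleIso.lean`)
carrying the orientation `o` to `o'` induces an ISOMORPHISM OF COMPLEX LINE BUNDLES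
`lineCore P o ≅ lineCore P' o'` — not `Φ` itself (an orientation-preserving real isomorphism of
oriented planes is complex linear only if conformal) but its **complex-linear part**: writing the
coordinate expression of `Φ_x` in oriented orthonormal frames as `z ↦ α z + β z̄`, orientation
preservation is `|α|² - |β|² = det > 0`, so `z ↦ α z` is a fibrewise `ℂ`-linear isomorphism,
continuous in `x` (Milnor–Stasheff, *Characteristic Classes* (1974), §14 p. 155: the complex
structure on an oriented plane bundle is unique up to homotopy / isomorphism; Husemoller,
*Fibre Bundles*, Ch. 3 §2, Ch. 5 §2 for bundle morphisms read in charts). Consequently the Euler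
classes agree (`Literature.AlgebraicTopology.CharacteristicClasses.eulerClass_iso`).

* `zPart`, `zbarPart` and the representation `cplxCoord_map_eq` (`κ'(Φ w) = α κ(w) + β κ̄(w)`),
  uniqueness `eq_of_forall_repr_eq`, `normSq_zPart_sub_normSq_zbarPart` (`= det`);
* `ProjBundle.IsIso.PreservesOrientation`;
* `ProjBundle.lineIsoCoeff`, its frame-change law and continuity, `lineIsoCoeff_ne_zero`;
* `ProjBundle.continuous_lineIsoMap`, `ProjBundle.continuous_lineIsoInvMap`;
* `ProjBundle.eulerClassOf_eq_of_isIso` — **equal Euler classes**.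

Everything here is proved; the definitions are data; no named facts.

## References

* J. Milnor, J. Stasheff, *Characteristic Classes* (1974), §14 p. 155. [MilnorStasheff1974]
* D. Husemoller, *Fibre Bundles*, 3rd ed. (1994), Ch. 3 §2, Ch. 5 §2. [HusemollerFibreBundles1994]
-/

open scoped Manifold ContDiff Topology RealInnerProductSpace ComplexConjugate
open Set Function Module Filter Complex Bundle

noncomputable section

namespace Literature.Topology.Immersions

/-- Local notation: `𝔼 n` is the model Euclidean space `EuclideanSpace ℝ (Fin n)`. -/
local notation "𝔼 " n:arg => EuclideanSpace ℝ (Fin n)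

open Literature.Topology.FourManifolds (leftInv leftInv_apply_self)

/-! ### The complex-linear and anti-linear parts of a real linear map between planes -/

section Algebra

variable {m m' : ℕ}

/-- **The complex-linear part** `α = ((t₁₁ + t₂₂) + i (t₂₁ - t₁₂)) / 2` of the `2 × 2` matrix
`tᵢⱼ = ⟪u'ᵢ, Φ uⱼ⟫` of `Φ` in the orthonormal pairs `u` (source) and `u'` (target). [folklore] -/
def zPart (u₁ u₂ : 𝔼 m) (u'₁ u'₂ : 𝔼 m') (Φ : 𝔼 m →L[ℝ] 𝔼 m') : ℂ :=
  (((⟪u'₁, Φ u₁⟫ + ⟪u'₂, Φ u₂⟫ : ℝ) : ℂ) + ((⟪u'₂, Φ u₁⟫ - ⟪u'₁, Φ u₂⟫ : ℝ) : ℂ) * I) / 2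

/-- **The anti-linear part** `β = ((t₁₁ - t₂₂) + i (t₂₁ + t₁₂)) / 2`. [folklore] -/
def zbarPart (u₁ u₂ : 𝔼 m) (u'₁ u'₂ : 𝔼 m') (Φ : 𝔼 m →L[ℝ] 𝔼 m') : ℂ :=
  (((⟪u'₁, Φ u₁⟫ - ⟪u'₂, Φ u₂⟫ : ℝ) : ℂ) + ((⟪u'₂, Φ u₁⟫ + ⟪u'₁, Φ u₂⟫ : ℝ) : ℂ) * I) / 2

/-- **`κ'(Φ w) = α κ(w) + β κ̄(w)`** for `w` in the plane spanned by the orthonormal pair `u`.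
[folklore] -/
theorem cplxCoord_map_eq {u₁ u₂ : 𝔼 m} (hu : OnPair u₁ u₂) {K : Submodule ℝ (𝔼 m)}
    (hK : finrank ℝ K = 2) (h₁ : u₁ ∈ K) (h₂ : u₂ ∈ K) (u'₁ u'₂ : 𝔼 m') (Φ : 𝔼 m →L[ℝ] 𝔼 m')
    {w : 𝔼 m} (hw : w ∈ K) :
    ProjBundle.cplxCoord u'₁ u'₂ (Φ w) =
      zPart u₁ u₂ u'₁ u'₂ Φ * ProjBundle.cplxCoord u₁ u₂ w +
        zbarPart u₁ u₂ u'₁ u'₂ Φ * conj (ProjBundle.cplxCoord u₁ u₂ w) := by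
  set p := ⟪u₁, w⟫
  set q := ⟪u₂, w⟫
  have ew : w = p • u₁ + q • u₂ := hu.expand hK h₁ h₂ hw
  have hΦ : Φ w = p • Φ u₁ + q • Φ u₂ := by
    conv_lhs => rw [ew]
    rw [map_add, map_smul, map_smul]
  have i₁ : ⟪u'₁, Φ w⟫ = p * ⟪u'₁, Φ u₁⟫ + q * ⟪u'₁, Φ u₂⟫ := by
    rw [hΦ, inner_add_right, inner_smul_right, inner_smul_right]
  have i₂ : ⟪u'₂, Φ w⟫ = p * ⟪u'₂, Φ u₁⟫ + q * ⟪u'₂, Φ u₂⟫ := by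
    rw [hΦ, inner_add_right, inner_smul_right, inner_smul_right]
  apply Complex.ext
  · simp [ProjBundle.cplxCoord, zPart, zbarPart, i₁, i₂]
    ring
  · simp [ProjBundle.cplxCoord, zPart, zbarPart, i₁, i₂]
    ring

/-- **Uniqueness of the representation** `z ↦ α z + β z̄`. [folklore] -/
theorem eq_of_forall_repr_eq {α β α' β' : ℂ} (h : ∀ z : ℂ, α * z + β * conj z = α' * z + β' * conj z) :
    α = α' ∧ β = β' := by
  have h1 := h 1
  have hI := h I
  simp only [map_one, mul_one, Complex.conj_I, mul_neg] at h1 hI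
  have h2 : α - β = α' - β' := by
    have : (α - β) * I = (α' - β') * I := by linear_combination hI
    exact mul_right_cancel₀ Complex.I_ne_zero this
  constructor
  · linear_combination (h1 + h2) / 2
  · linear_combination (h1 - h2) / 2

/-- **`|α|² - |β|² = det (tᵢⱼ)`.** [folklore] -/
theorem normSq_zPart_sub_normSq_zbarPart (u₁ u₂ : 𝔼 m) (u'₁ u'₂ : 𝔼 m') (Φ : 𝔼 m →L[ℝ] 𝔼 m') :
    Complex.normSq (zPart u₁ u₂ u'₁ u'₂ Φ) - Complex.normSq (zbarPart u₁ u₂ u'₁ u'₂ Φ) =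
      ⟪u'₁, Φ u₁⟫ * ⟪u'₂, Φ u₂⟫ - ⟪u'₁, Φ u₂⟫ * ⟪u'₂, Φ u₁⟫ := by
  simp [zPart, zbarPart, Complex.normSq_apply]
  ring

end Algebra

/-! ### Unit transition coefficients -/

namespace ProjBundle

variable {n m m' : ℕ} {M : Type*} [TopologicalSpace M] [ChartedSpace (𝔼 n) M]

section Coeff

variable {P : ProjBundle n m 2 M} {o : ∀ x, Orientation ℝ (P.fibre x) (Fin 2)}

/-- Every complex number is the complex coordinate of a vector of the plane. [folklore] -/
theorem exists_cplxCoord_eq {x₀ x : M} (z : ℂ) :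
    ∃ w ∈ P.fibre x, cplxCoord (P.gs₁ x₀ x) (P.ogs₂ o x₀ x) w = z ∨ x ∉ P.obaseSet o x₀ := by
  by_cases hx : x ∈ P.obaseSet o x₀
  · have hu := onPair_ogs hx
    refine ⟨z.re • P.gs₁ x₀ x + z.im • P.ogs₂ o x₀ x,
      Submodule.add_mem _ (Submodule.smul_mem _ _ (P.gs₁_mem x₀ x))
        (Submodule.smul_mem _ _ (P.ogs₂_mem o x₀ x)), Or.inl ?_⟩
    have huu : ⟪P.ogs₂ o x₀ x, P.gs₁ x₀ x⟫ = 0 := by rw [real_inner_comm]; exact hu.2.2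
    have h11 : ⟪P.gs₁ x₀ x, P.gs₁ x₀ x⟫ = 1 := by rw [real_inner_self_eq_norm_sq, hu.1, one_pow]
    have h22 : ⟪P.ogs₂ o x₀ x, P.ogs₂ o x₀ x⟫ = 1 := by
      rw [real_inner_self_eq_norm_sq, hu.2.1, one_pow]
    have e1 : ⟪P.gs₁ x₀ x, z.re • P.gs₁ x₀ x + z.im • P.ogs₂ o x₀ x⟫ = z.re := by
      rw [inner_add_right, inner_smul_right, inner_smul_right, h11, hu.2.2]; ring
    have e2 : ⟪P.ogs₂ o x₀ x, z.re • P.gs₁ x₀ x + z.im • P.ogs₂ o x₀ x⟫ = z.im := by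
      rw [inner_add_right, inner_smul_right, inner_smul_right, huu, h22]; ring
    rw [cplxCoord, e1, e2]
    exact Complex.re_add_im z
  · exact ⟨0, Submodule.zero_mem _, Or.inr hx⟩

/-- **The transition coefficients are unit complex numbers.** [folklore] -/
theorem normSq_lineCoeff {x₀ x₁ x : M} (hx₀ : x ∈ P.obaseSet o x₀) (hx₁ : x ∈ P.obaseSet o x₁) :
    Complex.normSq (P.lineCoeff o x₀ x₁ x) = 1 := by
  have hu := onPair_ogs hx₀
  have hv := onPair_ogs hx₁
  set a := ⟪P.gs₁ x₀ x, P.gs₁ x₁ x⟫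
  set b := ⟪P.ogs₂ o x₀ x, P.gs₁ x₁ x⟫
  have ev : P.gs₁ x₁ x = a • P.gs₁ x₀ x + b • P.ogs₂ o x₀ x :=
    hu.expand (P.finrank_fibre_two x) (P.gs₁_mem x₀ x) (P.ogs₂_mem o x₀ x) (P.gs₁_mem x₁ x)
  have huu : ⟪P.ogs₂ o x₀ x, P.gs₁ x₀ x⟫ = 0 := by rw [real_inner_comm]; exact hu.2.2
  have hab : a ^ 2 + b ^ 2 = 1 := by
    have h : ⟪P.gs₁ x₁ x, P.gs₁ x₁ x⟫ = 1 := by rw [real_inner_self_eq_norm_sq, hv.1, one_pow]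
    rw [ev] at h
    simp only [inner_add_left, inner_add_right, inner_smul_left, inner_smul_right,
      real_inner_self_eq_norm_sq, hu.1, hu.2.1, hu.2.2, huu, RCLike.conj_to_real] at h
    nlinarith [h]
  have ha : ⟪P.gs₁ x₁ x, P.gs₁ x₀ x⟫ = a := real_inner_comm _ _
  have hb : ⟪P.gs₁ x₁ x, P.ogs₂ o x₀ x⟫ = b := real_inner_comm _ _
  rw [lineCoeff, ha, hb, Complex.normSq_apply]
  simp
  nlinarith [hab]

/-- The reverse transition coefficient is the conjugate. [folklore] -/
theorem lineCoeff_swap {x₀ x₁ x : M} (hx₀ : x ∈ P.obaseSet o x₀) (hx₁ : x ∈ P.obaseSet o x₁) :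
    P.lineCoeff o x₁ x₀ x = conj (P.lineCoeff o x₀ x₁ x) := by
  have hc := lineCoeff_comp hx₀ hx₁ hx₀
  rw [lineCoeff_self hx₀] at hc
  -- `c' * c = 1` and `|c|² = 1` give `c' = conj c`
  have hn := normSq_lineCoeff hx₀ hx₁
  have hne : P.lineCoeff o x₀ x₁ x ≠ 0 := by
    intro h; rw [h, map_zero] at hn; exact zero_ne_one hn
  have hinv : P.lineCoeff o x₁ x₀ x = (P.lineCoeff o x₀ x₁ x)⁻¹ := eq_inv_of_mul_eq_one_left hc
  rw [hinv, Complex.inv_def, hn]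
  simp

end Coeff

/-! ### The complex-linear part of an isomorphism, in oriented orthonormal frames -/

section IsoCoeff

variable (P : ProjBundle n m 2 M) (P' : ProjBundle n m' 2 M)
  (o : ∀ x, Orientation ℝ (P.fibre x) (Fin 2)) (o' : ∀ x, Orientation ℝ (P'.fibre x) (Fin 2))
  (Φ : M → 𝔼 m →L[ℝ] 𝔼 m')

/-- **`α_{i,j}(x)`**: the complex-linear part of `Φ_x` from the oriented orthonormal frame of the
chart `i` of `P` to that of the chart `j` of `P'`. [folklore] -/
def lineIsoCoeff (i j x : M) : ℂ := zPart (P.gs₁ i x) (P.ogs₂ o i x) (P'.gs₁ j x) (P'.ogs₂ o' j x) (Φ x)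

variable {P P' o o' Φ}

/-- **Frame-change law**: `α_{i',j'} = c'_{j j'} · conj (c_{i i'}) · α_{i,j}`. [folklore] -/
theorem lineIsoCoeff_change {i i' j j' x : M}
    (hi : x ∈ P.obaseSet o i) (hi' : x ∈ P.obaseSet o i') (hj : x ∈ P'.obaseSet o' j)
    (hj' : x ∈ P'.obaseSet o' j') :
    lineIsoCoeff P P' o o' Φ i' j' x =
      P'.lineCoeff o' j j' x * conj (P.lineCoeff o i i' x) * lineIsoCoeff P P' o o' Φ i j x := by
  -- compare the two representations of `κ'_{j'} (Φ w)` in terms of `κ_{i'} w`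
  have hu := onPair_ogs hi
  have hu' := onPair_ogs hi'
  have h2 := P.finrank_fibre_two x
  set c := P.lineCoeff o i i' x
  set c' := P'.lineCoeff o' j j' x
  have hcc : conj c * c = 1 := by
    rw [mul_comm, Complex.mul_conj, normSq_lineCoeff hi hi']; simp
  have key : ∀ z : ℂ,
      lineIsoCoeff P P' o o' Φ i' j' x * z + zbarPart (P.gs₁ i' x) (P.ogs₂ o i' x)
        (P'.gs₁ j' x) (P'.ogs₂ o' j' x) (Φ x) * conj z =
      (c' * conj c * lineIsoCoeff P P' o o' Φ i j x) * z +
        (c' * c * zbarPart (P.gs₁ i x) (P.ogs₂ o i x) (P'.gs₁ j x) (P'.ogs₂ o' j x) (Φ x)) * conj z := by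
    intro z
    obtain ⟨w, hw, hwz | hno⟩ := exists_cplxCoord_eq (P := P) (o := o) (x₀ := i') (x := x) z
    swap
    · exact absurd hi' hno
    rw [← hwz]
    -- left: representation in the frames `(i', j')`
    have hL := cplxCoord_map_eq hu' h2 (P.gs₁_mem i' x) (P.ogs₂_mem o i' x) (P'.gs₁ j' x)
      (P'.ogs₂ o' j' x) (Φ x) hw
    -- right: representation in `(i, j)`, transported
    have hR := cplxCoord_map_eq hu h2 (P.gs₁_mem i x) (P.ogs₂_mem o i x) (P'.gs₁ j x)
      (P'.ogs₂ o' j x) (Φ x) hw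
    have hκ : cplxCoord (P.gs₁ i' x) (P.ogs₂ o i' x) w = c * cplxCoord (P.gs₁ i x) (P.ogs₂ o i x) w :=
      cplxCoord_eq_lineCoeff_mul hi hi' w
    have hκ' : cplxCoord (P'.gs₁ j' x) (P'.ogs₂ o' j' x) (Φ x w) =
        c' * cplxCoord (P'.gs₁ j x) (P'.ogs₂ o' j x) (Φ x w) :=
      cplxCoord_eq_lineCoeff_mul hj hj' (Φ x w)
    have hκi : cplxCoord (P.gs₁ i x) (P.ogs₂ o i x) w =
        conj c * cplxCoord (P.gs₁ i' x) (P.ogs₂ o i' x) w := by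
      rw [hκ, ← mul_assoc, hcc, one_mul]
    rw [lineIsoCoeff, ← hL, hκ', hR, lineIsoCoeff, hκi, map_mul, Complex.conj_conj]
    ring
  exact (eq_of_forall_repr_eq key).1

/-- **Continuity of `α_{i,j}`** on the overlap of the base sets. [folklore] -/
theorem continuousOn_lineIsoCoeff (hΦc : Continuous Φ) (i j : M) :
    ContinuousOn (lineIsoCoeff P P' o o' Φ i j) (P.goodSet i ∩ P'.goodSet j) := by
  have hΦ' : ∀ {g : M → 𝔼 m}, ContinuousOn g (P.goodSet i ∩ P'.goodSet j) →
      ContinuousOn (fun x => Φ x (g x)) (P.goodSet i ∩ P'.goodSet j) :=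
    fun hg => hΦc.continuousOn.clm_apply hg
  have h1 := (P.continuousOn_gs₁ i).mono (inter_subset_left (t := P'.goodSet j))
  have h2 := (P.continuousOn_ogs₂ o i).mono (inter_subset_left (t := P'.goodSet j))
  have h3 := (P'.continuousOn_gs₁ j).mono (inter_subset_right (s := P.goodSet i))
  have h4 := (P'.continuousOn_ogs₂ o' j).mono (inter_subset_right (s := P.goodSet i))
  have t11 : ContinuousOn (fun x => ⟪P'.gs₁ j x, Φ x (P.gs₁ i x)⟫) (P.goodSet i ∩ P'.goodSet j) :=
    fun x hx => ContinuousWithinAt.inner (𝕜 := ℝ) (h3 x hx) (hΦ' h1 x hx)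
  have t22 : ContinuousOn (fun x => ⟪P'.ogs₂ o' j x, Φ x (P.ogs₂ o i x)⟫) (P.goodSet i ∩ P'.goodSet j) :=
    fun x hx => ContinuousWithinAt.inner (𝕜 := ℝ) (h4 x hx) (hΦ' h2 x hx)
  have t21 : ContinuousOn (fun x => ⟪P'.ogs₂ o' j x, Φ x (P.gs₁ i x)⟫) (P.goodSet i ∩ P'.goodSet j) :=
    fun x hx => ContinuousWithinAt.inner (𝕜 := ℝ) (h4 x hx) (hΦ' h1 x hx)
  have t12 : ContinuousOn (fun x => ⟪P'.gs₁ j x, Φ x (P.ogs₂ o i x)⟫) (P.goodSet i ∩ P'.goodSet j) :=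
    fun x hx => ContinuousWithinAt.inner (𝕜 := ℝ) (h3 x hx) (hΦ' h2 x hx)
  unfold lineIsoCoeff zPart
  exact ((continuous_ofReal.comp_continuousOn (t11.add t22)).add
    ((continuous_ofReal.comp_continuousOn (t21.sub t12)).mul continuousOn_const)).div_const _

end IsoCoeff

/-! ### Orientation-preserving isomorphisms -/

section Iso

variable (P : ProjBundle n m 2 M) (P' : ProjBundle n m' 2 M)
  (o : ∀ x, Orientation ℝ (P.fibre x) (Fin 2)) (o' : ∀ x, Orientation ℝ (P'.fibre x) (Fin 2))
  (Φ : M → 𝔼 m →L[ℝ] 𝔼 m')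

/-- **`Φ` carries the orientation `o` to `o'`**: positive frames of `E_x` go to positive frames
of `E'_x`. [cite: MilnorStasheff1974, §9 p. 96] -/
structure PreservesOrientation (P : ProjBundle n m 2 M) (P' : ProjBundle n m' 2 M)
    (o : ∀ x, Orientation ℝ (P.fibre x) (Fin 2)) (o' : ∀ x, Orientation ℝ (P'.fibre x) (Fin 2))
    (Φ : M → 𝔼 m →L[ℝ] 𝔼 m') : Prop where
  map_pos : ∀ (x : M) (A : 𝔼 2 →L[ℝ] 𝔼 m) (hA : Injective A)
    (hr : LinearMap.range A.toLinearMap = P.fibre x) (hA' : Injective ((Φ x).comp A))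
    (hr' : LinearMap.range ((Φ x).comp A).toLinearMap = P'.fibre x),
    P.orientationOfFrame A hA hr = o x → P'.orientationOfFrame ((Φ x).comp A) hA' hr' = o' x

variable {P P' o o' Φ}

/-- **Orientation preservation makes the complex-linear part dominate**: `|α|² > |β|²`, in
particular `α_{i,j}(x) ≠ 0`. [folklore] -/
theorem lineIsoCoeff_ne_zero (hiso : IsIso P P' Φ) (hpo : PreservesOrientation P P' o o' Φ)
    {i j x : M} (hi : x ∈ P.obaseSet o i) (hj : x ∈ P'.obaseSet o' j) :
    lineIsoCoeff P P' o o' Φ i j x ≠ 0 := by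
  have hu := onPair_ogs hi
  have hu' := onPair_ogs hj
  have h2' := P'.finrank_fibre_two x
  -- the positive frame `U` of `E_x` and its image `Φ U`, a frame of `E'_x`
  set U := frameOf (P.gs₁ i x) (P.ogs₂ o i x)
  have hU : Injective U := hu.injective_frameOf
  have hrU : LinearMap.range U.toLinearMap = P.fibre x :=
    hu.range_frameOf_eq (P.finrank_fibre_two x) (P.gs₁_mem i x) (P.ogs₂_mem o i x)
  have hmemU : ∀ c, U c ∈ P.fibre x := fun c => hrU ▸ LinearMap.mem_range_self _ c
  have hΦU : Injective ((Φ x).comp U) := fun c c' h =>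
    hU (hiso.injOn x (hmemU c) (hmemU c') h)
  have hrΦU : LinearMap.range ((Φ x).comp U).toLinearMap = P'.fibre x := by
    apply le_antisymm
    · rintro _ ⟨c, rfl⟩
      exact hiso.mapsTo x _ (hmemU c)
    · intro w hw
      obtain ⟨v, hv, rfl⟩ := (hiso.bijOn x).surjOn hw
      obtain ⟨c, rfl⟩ : v ∈ LinearMap.range U.toLinearMap := hrU ▸ hv
      exact ⟨c, rfl⟩
  have hoU : P.orientationOfFrame U hU hrU = o x := orientationOfFrame_ogs hi
  have hoΦU : P'.orientationOfFrame ((Φ x).comp U) hΦU hrΦU = o' x :=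
    hpo.map_pos x U hU hrU hΦU hrΦU hoU
  -- compare with the positive frame `U'` of `E'_x`
  set U' := frameOf (P'.gs₁ j x) (P'.ogs₂ o' j x)
  have hoU' : P'.orientationOfFrame U' hu'.injective_frameOf
      (hu'.range_frameOf_eq h2' (P'.gs₁_mem j x) (P'.ogs₂_mem o' j x)) = o' x := orientationOfFrame_ogs hj
  have hpos := (P'.orientationOfFrame_eq_iff_det_pos U' ((Φ x).comp U) hu'.injective_frameOf hΦU
    (hu'.range_frameOf_eq h2' (P'.gs₁_mem j x) (P'.ogs₂_mem o' j x)) hrΦU).1 (hoU'.trans hoΦU.symm)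
  rw [← det_stdMat, Matrix.det_fin_two] at hpos
  -- the transition matrix has entries `⟪u'_k, Φ u_l⟫`
  have hcol : ∀ w ∈ P'.fibre x, leftInv U' w = coord2 ⟪P'.gs₁ j x, w⟫ ⟪P'.ogs₂ o' j x, w⟫ := by
    intro w hw
    have ew := hu'.expand h2' (P'.gs₁_mem j x) (P'.ogs₂_mem o' j x) hw
    conv_lhs => rw [ew, ← frameOf_coord2]
    exact leftInv_apply_self hu'.injective_frameOf _
  have e0 : frameTransition U' ((Φ x).comp U) (EuclideanSpace.single 0 1) =
      coord2 ⟪P'.gs₁ j x, Φ x (P.gs₁ i x)⟫ ⟪P'.ogs₂ o' j x, Φ x (P.gs₁ i x)⟫ := by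
    show leftInv U' (Φ x (U (EuclideanSpace.single 0 1))) = _
    rw [show U (EuclideanSpace.single 0 1) = P.gs₁ i x from frameOf_single_zero _ _]
    exact hcol _ (hiso.mapsTo x _ (P.gs₁_mem i x))
  have e1 : frameTransition U' ((Φ x).comp U) (EuclideanSpace.single 1 1) =
      coord2 ⟪P'.gs₁ j x, Φ x (P.ogs₂ o i x)⟫ ⟪P'.ogs₂ o' j x, Φ x (P.ogs₂ o i x)⟫ := by
    show leftInv U' (Φ x (U (EuclideanSpace.single 1 1))) = _
    rw [show U (EuclideanSpace.single 1 1) = P.ogs₂ o i x from frameOf_single_one _ _]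
    exact hcol _ (hiso.mapsTo x _ (P.ogs₂_mem o i x))
  simp only [stdMat, Matrix.of_apply, e0, e1, coord2_apply_zero, coord2_apply_one] at hpos
  -- `|α|² - |β|² = det > 0`
  have hd := normSq_zPart_sub_normSq_zbarPart (P.gs₁ i x) (P.ogs₂ o i x) (P'.gs₁ j x)
    (P'.ogs₂ o' j x) (Φ x)
  intro h0
  rw [lineIsoCoeff] at h0
  rw [h0, map_zero, zero_sub] at hd
  have hnn := Complex.normSq_nonneg (zbarPart (P.gs₁ i x) (P.ogs₂ o i x) (P'.gs₁ j x)
    (P'.ogs₂ o' j x) (Φ x))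
  linarith

/-- **The fibrewise complex-linear isomorphism** `z ↦ α_{x,x}(x) z` at `x` (in the distinguished
charts of the two line cores). [folklore] -/
def lineIsoEquiv (ho : P.IsOrientation o) (ho' : P'.IsOrientation o') (hiso : IsIso P P' Φ)
    (hpo : PreservesOrientation P P' o o' Φ) (x : M) : ℂ ≃L[ℂ] ℂ :=
  ContinuousLinearEquiv.unitsEquivAut ℂ (Units.mk0 (lineIsoCoeff P P' o o' Φ x x x)
    (lineIsoCoeff_ne_zero hiso hpo (mem_obaseSet_self ho x) (mem_obaseSet_self ho' x)))

/-- The fibre isomorphism is multiplication by `α_{x,x}(x)`. [folklore] -/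
theorem lineIsoEquiv_apply (ho : P.IsOrientation o) (ho' : P'.IsOrientation o') (hiso : IsIso P P' Φ)
    (hpo : PreservesOrientation P P' o o' Φ) (x : M) (z : ℂ) :
    lineIsoEquiv ho ho' hiso hpo x z = z * lineIsoCoeff P P' o o' Φ x x x := by
  rw [lineIsoEquiv, ContinuousLinearEquiv.unitsEquivAut_apply]
  rfl

/-- **Continuity of the induced map of total spaces** `lineCore P o → lineCore P' o'`.
[cite: HusemollerFibreBundles1994, Ch. 5 §2] -/
theorem continuous_lineIsoMap (ho : P.IsOrientation o) (ho' : P'.IsOrientation o')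
    (hiso : IsIso P P' Φ) (hpo : PreservesOrientation P P' o o' Φ) :
    Continuous fun q : (P.lineCore o ho).TotalSpace =>
      (⟨q.proj, lineIsoEquiv ho ho' hiso hpo q.proj q.2⟩ : (P'.lineCore o' ho').TotalSpace) := by
  refine (P.lineCore o ho).continuous_totalSpace_map (P'.lineCore o' ho') continuous_id
    (fun b v => lineIsoEquiv ho ho' hiso hpo b v) fun b₀ v => ?_
  have hΦc : Continuous Φ := hiso.contMDiff.continuous
  -- the local expression is `α_{b₀,b₀}(b) * z` near `b₀`
  have hS : P.obaseSet o b₀ ∩ P'.obaseSet o' b₀ ∈ 𝓝 b₀ :=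
    inter_mem ((P.isOpen_obaseSet o b₀).mem_nhds (mem_obaseSet_self ho b₀))
      ((P'.isOpen_obaseSet o' b₀).mem_nhds (mem_obaseSet_self ho' b₀))
  have hcont : ContinuousAt (fun q : M × ℂ => lineIsoCoeff P P' o o' Φ b₀ b₀ q.1 * q.2) (b₀, v) := by
    have h1 : ContinuousAt (lineIsoCoeff P P' o o' Φ b₀ b₀) b₀ :=
      (continuousOn_lineIsoCoeff hΦc b₀ b₀).continuousAt (Filter.mem_of_superset hS
        (inter_subset_inter (P.obaseSet_subset_goodSet o b₀) (P'.obaseSet_subset_goodSet o' b₀)))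
    have h2 : ContinuousAt (fun q : M × ℂ => lineIsoCoeff P P' o o' Φ b₀ b₀ q.1) (b₀, v) :=
      ContinuousAt.comp (f := Prod.fst) (x := (b₀, v)) h1 continuousAt_fst
    exact h2.mul continuousAt_snd
  refine hcont.congr ?_
  have hS' : (P.obaseSet o b₀ ∩ P'.obaseSet o' b₀) ×ˢ (univ : Set ℂ) ∈ 𝓝 (b₀, v) :=
    prod_mem_nhds hS univ_mem
  filter_upwards [hS'] with q hq
  obtain ⟨⟨hq₁, hq₂⟩, -⟩ := hq
  show lineIsoCoeff P P' o o' Φ b₀ b₀ q.1 * q.2 =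
    (P'.lineCore o' ho').coordChange q.1 b₀ q.1
      (lineIsoEquiv ho ho' hiso hpo q.1 ((P.lineCore o ho).coordChange b₀ q.1 q.1 q.2))
  rw [lineCore_coordChange, lineIsoEquiv_apply, lineCore_coordChange,
    lineIsoCoeff_change (i := q.1) (j := q.1) (i' := b₀) (j' := b₀) (mem_obaseSet_self ho q.1) hq₁
      (mem_obaseSet_self ho' q.1) hq₂,
    ← lineCoeff_swap (mem_obaseSet_self ho q.1) hq₁]
  ring

end Iso

/-! ### Equality of the Euler classes -/

section Euler

open Literature.AlgebraicTopology.CharacteristicClasses (eulerClass_iso)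

variable {M : Type} [TopologicalSpace M] [T2Space M] [ParacompactSpace M] [ChartedSpace (𝔼 n) M]
  {P : ProjBundle n m 2 M} {P' : ProjBundle n m' 2 M}
  {o : ∀ x, Orientation ℝ (P.fibre x) (Fin 2)} {o' : ∀ x, Orientation ℝ (P'.fibre x) (Fin 2)}
  {Φ : M → 𝔼 m →L[ℝ] 𝔼 m'}

/-- **Orientation-preservingly isomorphic oriented plane bundles have the same Euler class.**
[cite: MilnorStasheff1974, §14 p. 155; HusemollerFibreBundles1994, Ch. 17 Prop. 3.3] -/
theorem eulerClassOf_eq_of_isIso (ho : P.IsOrientation o) (ho' : P'.IsOrientation o')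
    (hiso : IsIso P P' Φ) (hpo : PreservesOrientation P P' o o' Φ) :
    P.eulerClassOf o ho = P'.eulerClassOf o' ho' :=
  eulerClass_iso ℂ (P.lineCore o ho).Fiber finrank_complex_self ℤ ℂ (P'.lineCore o' ho').Fiber
    finrank_complex_self (lineIsoEquiv ho ho' hiso hpo) (continuous_lineIsoMap ho ho' hiso hpo) 1

end Euler

end ProjBundle

end Literature.Topology.Immersions
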